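import Literature.NumberTheory.EllipticCurves.BurungaleSkinnerTianWan2024.GreenbergMainStatementOrdinaryProofs
import Literature.NumberTheory.EllipticCurves.YanZhu2026.GreenbergDivisibilityProofs
import HarnessLib

/-!
# Burungale–Skinner–Tian–Wan Thm. 9.24 (GMC_r) for an elliptic curve at a good ORDINARY prime, with the
# cyclotomic localisation REMOVED: the full Greenberg divisibility `ch(X_Gr(E/L_∞))Λ^ur ⊆ (𝓛_p^Gr)` on
# the Yan–Zhu locus (`D_L` odd, `≠ −3`, Heegner) below REFEREED print — PROOFS ONLY

`Proofs` companion (theorems only: no definition, no named fact, no instance) of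
`GreenbergMainStatementOrdinaryProofs.lean` (seat `bsd-littype-01`, gen 5:
`exists_cyc_mul_charIdealXGr₂_le_of_goodOrd_of_yanZhu` = the OPEN binder's conclusion "after inverting
the non-zero elements of the cyclotomic algebra" as a theorem below two refereed Yan–Zhu facts) and of
`YanZhu2026/GreenbergDivisibilityProofs.lean` (seat `bsd-littype-04`, gen 5: the second step of the proof
of [YZ26, Thm. 4.2 (2)], `charIdealXGr₂_map_le_span_of_facts`).

Paper of record for the SHAPE: A. Burungale, C. Skinner, Y. Tian, X. Wan, arXiv:2409.01350v2 (UNREFEREED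
PREPRINT), Thm. 9.24 (GMC_r, pp. 85–86): the Greenberg divisibility "after inverting the non-zero elements
of `Λ^{cyc}`". The content proved here is [YZ26] = X. Yan, X. Zhu, J. Algebra 693 (2026), Thm. 4.2 (2)
(arXiv:2412.20078v4 TeX l.932–940, proof l.1036–1050): `Char_{Λ_K}(𝒳_{𝓕_Gr}(E/K_∞))Λ_K^ur ⊂ (𝓛_p^Gr(E/K))`,
WITHOUT localisation, assembled in the kernel from its printed inputs (Cor. 4.6, Thm. 4.7, Prop. 3.14,
[BCS25, Prop. 4.2.2] = [Hsieh14, Thm. B]).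

WHAT IS PROVED (`charIdealXGr₂_map_le_span_of_goodOrd_of_heegner_of_yanZhu`): take the hypothesis list of
`exists_cyc_mul_charIdealXGr₂_le_of_goodOrd_of_yanZhu` (the OPEN binder's language: `N = N_E`, `p ≠ 2`
good ORDINARY, `L = K` imaginary quadratic, (ord) `p = v v̄` with `v` induced by `ι`, `(N, D_K) = 1`,
`D_K` odd, `D_K ≠ −3`, (irr_L) framed, `(κ₁, κ₂)` = (cyc, anti), a Katz frame `LK`, a reduction-type-free
Greenberg frame `G` at the inverse generators, a structure-compatible `J`), ADD the Heegner hypothesis for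
`(N, K)`, and grant — besides `thm47_…AnyRoot…`, `cor46_…` and `nonempty_modularParametrizationData` — the
two refereed facts behind `μ(𝓛_p^Gr(E/K)⁻) = 0`: `YanZhu2026.prop314_span_minus_eq_span_bdp_anyRoot`
([YZ26, Prop. 3.14] = [CGS25, Prop. 2.4.5]) and `BurungaleCastellaSkinner2025.prop422_exists_isBDPLFunction_mu_eq_zero`
([BCS25, Prop. 4.2.2], the `L_p^BDP` half = [Hsieh14, Thm. B]). CONCLUSION: the FULL divisibility
`ch(X_Gr(E/K_∞))·𝒪_{ℂ_p}⟦T₁,T₂⟧ ⊆ (G)` — the localisation of Thm. 9.24's conclusion is gone. So at a good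
ORDINARY `p`, on the locus (disc) + (Heeg), the two-variable Greenberg divisibility for `g = f_E` is
kernel-proved modulo four REFEREED named facts + modularity; the preprint content of Thm. 9.24 there is nil.

## References
* [BurungaleSkinnerTianWan2024] arXiv:2409.01350v2, Thm. 9.24 (pp. 85–86; label GMC_r) — shape only.
* [YanZhu2024MainConjNonCM] J. Algebra 693 (2026) = arXiv:2412.20078v4: Thm. 4.2 (2) (l.932–940) and its
  proof (l.1036–1050); Thm. 4.7, Cor. 4.6, Prop. 3.14.
* [BurungaleCastellaSkinner2025] arXiv:2405.00270v2, Prop. 4.2.2 (p. 9). [Hsieh2014] Thm. B.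
-/

noncomputable section

open scoped Classical

open PowerSeries NumberField IsDedekindDomain Field CongruenceSubgroup
  Literature.NumberTheory.GaloisRepresentations Literature.NumberTheory.EllipticCurves
  Literature.NumberTheory.EllipticCurves.ModularForms Literature.NumberTheory.EllipticCurves.Rank1Residual

namespace Literature.NumberTheory.EllipticCurves.BurungaleSkinnerTianWan2024

open IwasawaAlgebra₂ YanZhu2026 BurungaleCastellaSkinner2025

/-- **BSTW Thm. 9.24 (GMC_r), `E`-instance at a good ORDINARY prime, localisation removed** — on the
Yan–Zhu locus `D_K` odd, `D_K ≠ −3` WITH the Heegner hypothesis: granted the refereed facts `h47`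
([YZ26, Thm. 4.7]), `h46` ([YZ26, Cor. 4.6]), `h314` ([YZ26, Prop. 3.14]), `h422` ([BCS25, Prop. 4.2.2]
= [Hsieh14, Thm. B]) and modularity `hmod`, for the binder's data (see module docstring) the FULL
Greenberg divisibility holds: `ch(X_Gr(E/K_∞))·𝒪_{ℂ_p}⟦T₁,T₂⟧ ⊆ (G)`. Proof: [YZ26]'s proof of Thm. 4.2
(2) in the kernel (`YanZhu2026.charIdealXGr₂_map_le_span_of_facts`), over the glue of
`exists_cyc_mul_charIdealXGr₂_le_of_goodOrd_of_yanZhu` (`ι₁ := ι⁻¹|_{ℤ̄}` completed, (irr_K) from the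
framed (irr_L), `f = π.f` by multiplicity one).
[cite: YanZhu2024MainConjNonCM, Thm. 4.2 (2) (arXiv:2412.20078v4 TeX l.932–940) and proof l.1036–1050, with Thm. 4.7 (l.1022–1034), Cor. 4.6 (l.996–1003), Prop. 3.14 (l.896–903)]
[cite: BurungaleSkinnerTianWan2024, Thm. 9.24 first clause (pp. 85–86; label GMC_r) (shape of the hypotheses; OPEN binder not used)]
[cite: BurungaleCastellaSkinner2025, Prop. 4.2.2 (p. 9 of arXiv:2405.00270v2)] -/
theorem charIdealXGr₂_map_le_span_of_goodOrd_of_heegner_of_yanZhu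
    (h47 : YanZhu2026.thm47_ord_localised_iff_greenbergAnyRoot_localised)
    (h46 : YanZhu2026.cor46_XOrd₂_charIdeal_le_perrinRiou_awayFromPlus)
    (h314 : YanZhu2026.prop314_span_minus_eq_span_bdp_anyRoot)
    (h422 : BurungaleCastellaSkinner2025.prop422_exists_isBDPLFunction_mu_eq_zero)
    (hmod : nonempty_modularParametrizationData)
    {p : ℕ} [Fact p.Prime] (ι : PadicAlgCl p ≃+* ℂ) (W : WeierstrassCurve ℚ) [W.IsElliptic]
    [W.IsGloballyMinimal] (K : Type) [Field K] [NumberField K] (v vbar : HeightOneSpectrum (𝓞 K))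
    (κ₁ κ₂ : ZpExtension K p) (γ₁ γ₂ : absoluteGaloisGroup K)
    [Fact (ZpExtension.IsTopGeneratorPair κ₁ κ₂ γ₁ γ₂)] {N : ℕ} [NeZero N] {f : CuspForm (Gamma0 N) 2}
    (hf : IsNewformOf W f) [NeZero (NumberField.discr K).natAbs]
    -- `g = f_E` of level `N = N_E`, `p ≠ 2` good ORDINARY
    (hN : (N : ℤ) = W.conductorNorm ℤ) (hp2 : p ≠ 2) (hGO : GoodOrd W p)
    -- `L = K` imaginary quadratic; (ord) `p = v v̄`, `v` induced by `ι`; `(N, D_K) = 1`; (disc); (Heeg)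
    (hK : IsImaginaryQuadratic K) (hsplit : ((Ideal.span {(p : ℤ)}).primesOver (𝓞 K)).ncard = 2)
    (hv : ((p : ℕ) : 𝓞 K) ∈ v.asIdeal) (hvbar : ((p : ℕ) : 𝓞 K) ∈ vbar.asIdeal) (hne : vbar ≠ v)
    (hcompat : ∀ (w : InfinitePlace K) (k : 𝓞 K), k ∈ v.asIdeal ↔ ‖ι.symm (w.embedding (k : K))‖ < 1)
    (hcop : IsCoprime (N : ℤ) (NumberField.discr K)) (hodd : Odd (NumberField.discr K))
    (hne3 : NumberField.discr K ≠ -3) (hH : SatisfiesHeegnerHypothesis N K)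
    -- (irr_L), framed
    (hirr : ∀ ρ : ModPGaloisRep K (ZMod p) 2, (W.baseChange K).IsTorsionGaloisRep p ρ →
      FramedRep.IsAbsolutelyIrreducible ρ)
    -- the `ℤ_p²`-tower
    (hκ₁ : κ₁.IsCyclotomic) (hκ₂ : κ₂.IsAnticyclotomic)
    -- a Katz frame and a reduction-type-free Greenberg frame at the inverse generators
    {Ω δ : ℂ} {Ωp : (unrIntegers p)ˣ} {LK G : PowerSeries (PowerSeries (PadicComplexInt p))}
    (hLK : IsKatzMeasure₂ ι v vbar ∅ κ₁ κ₂ γ₁⁻¹ γ₂⁻¹ 1 Ω δ ((Ωp : unrIntegers p) : ℂ_[p]) LK)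
    (hG : IsGreenbergLFunctionAnyRoot₂ ι v vbar κ₁ κ₂ γ₁⁻¹ γ₂⁻¹ f (NumberField.discr K).natAbs
      (NumberField.classNumber K) LK G)
    (J : ℤ_[p] →+* PadicComplexInt p)
    (hJ : ∀ x : ℤ_[p], ((J x : PadicComplexInt p) : ℂ_[p]) = ((x : ℚ_[p]) : ℂ_[p])) :
    (WeierstrassCurve.XGr₂.charIdeal (W.baseChange K) p κ₁ κ₂ vbar γ₁ γ₂).map (toUnr₂ p J) ≤
      Ideal.span {G} := by
  -- the level is `N_E`: transport the modular parametrisation datum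
  obtain rfl : N = W.conductorNorm ℤ := by exact_mod_cast hN
  obtain ⟨π⟩ := hmod W
  -- multiplicity one: the binder's newform is the datum's newform
  obtain rfl : f = π.f := hf.unique π.isNewformOf
  -- `p > 2`
  have h3 : 3 ≤ p := by
    have h2 := (Fact.out : p.Prime).two_le
    omega
  -- Yan–Zhu's standing data
  have hset : YanZhu2026.GreenbergSetting ι W (W.conductorNorm ℤ) K v vbar κ₁ κ₂ :=
    { level := rfl
      three_le := h3
      goodOrd := hGO
      isImaginaryQuadratic := hK
      split := hsplit
      mem_v := hv
      mem_vbar := hvbar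
      vbar_ne := hne
      compat := hcompat
      coprime := hcop
      discr_odd := hodd
      discr_ne := hne3
      cyclotomic := hκ₁
      anticyclotomic := hκ₂ }
  haveI : (W.baseChange K).IsElliptic := by rw [WeierstrassCurve.baseChange]; infer_instance
  -- [YZ26]'s proof of Thm. 4.2 (2), both steps, in the kernel
  exact YanZhu2026.charIdealXGr₂_map_le_span_of_facts h46 h47 h314 h422
    ((algebraMap (PadicAlgCl p) ℂ_[p]).comp
      (ι.symm.toRingHom.comp (integralClosure ℚ ℂ).val.toRingHom)) ι W K v vbar κ₁ κ₂ γ₁ γ₂ π hset hH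
    (hasIrreducibleModPGaloisRep_of_forall_isAbsolutelyIrreducible (W.baseChange K) p hirr)
    (fun _ ↦ rfl) hLK hG J hJ

end Literature.NumberTheory.EllipticCurves.BurungaleSkinnerTianWan2024

end
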